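import Summits.RiemannHypothesis.RiemannHypothesis.Theorems.TiltedLandingLaw421TwoSidedClasses

/-! # TiltedLandingLaw421E3Lineage
W-07 E3 §L LINEAGE SOCKET (C1 rh-idea-5 g20, `sectionL` 21baf4f6: `injected`-free (iv) cell tokens `LineageLawG` / `RestBudgetG` / `census_of_lineage` …) ++
§S′ BOOKING METER (C1 g21, `sectionSr` cd176ee6: `injected`, `bookingMeter`, `lineageLawG_iff_booking_nonneg`, `booking_sandwich`, 𝓔-trade monotonicities). READMEs: `pub/ideators/rh-idea-5/g21/w07e3/README-sectionS-E-E4.md`.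
SUPPORT module for crux `TiltedLandingLaw421` (stmt-RiemannHypothesis-24774), `--supports` only: proves no stub, no crux; fully proved (no `sorry`).
Cut by tenure rh-tenure-earlyapp-1 g4 per director (CA261)(C2) from the authors' farm-checked sections (decl blocks byte-verbatim; section `/-! -/` prose and
`#print axioms` lines dropped, mechanical docstrings added where absent); K = kernel-checked lemmas about MODEL sockets (combs), not ζ/Ξ. RH is not proved. -/

namespace RhW07.C14.Lineage

open Complex
open RhIdea6.G17.W07C7 RhIdea6.G17.W07C7.Rev6 RhIdea6.G18.W07C8.Law421BirthS RhIdea6.G19.W07C11.Seam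
open RhIdea6.G20.W07C12.Frac RhIdea6.G20.W07C12.StColP RhW07.C12.FieldSplit
open RhW07.C14.TwoSided RhW07.C14.Classes

open Classical in
/-- **LINEAGE LAW** (count level, exit-free, lam-free): the charged levels below `k` outside 𝓔 number at most the initial meter reading plus
the settlers consumed below `k`. -/
def LineageLawG (P St Ready : StatePred) (𝓔 : LevelClass) (σ M : LevelMeter) : Prop :=
  ∀ (η : ℝ) (f : ℂ → ℂ) (x₀ s hmax R Hs : ℝ) (B : ℕ), EngineHyps5 2 η f x₀ s hmax R Hs B →
    ∀ k : ℕ, (∑ j ∈ Finset.range k,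
        (if Charged P St Ready η f x₀ s hmax R Hs B j ∧ ¬ 𝓔 η f x₀ s hmax R Hs B j then (1 : ℝ) else 0))
      ≤ M η f x₀ s hmax R Hs B 0 + σ η f x₀ s hmax R Hs B k

set_option linter.unusedVariables false in
open Classical in
/-- **REST BUDGET**: lifts `lam ≥ 0` with successors inside the lift at every charged level, and the settlers plus the 𝓔-charges plus ALL lift
tolls below `k` fit in `β`. -/
def RestBudgetG (μ : ℝ) (P St Ready : StatePred) (𝓔 : LevelClass) (σ : LevelMeter) (β : Budget) (M : LevelMeter) : Prop :=
  ∀ (η : ℝ) (f : ℂ → ℂ) (x₀ s hmax R Hs : ℝ) (B : ℕ), EngineHyps5 2 η f x₀ s hmax R Hs B →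
    ∃ lam : ℕ → ℝ, (∀ j : ℕ, 0 ≤ lam j) ∧
      (∀ j : ℕ, Charged P St Ready η f x₀ s hmax R Hs B j →
        ∀ u : ℂ, St η f x₀ s hmax R Hs B j u → ¬ Ready η f x₀ s hmax R Hs B j u →
          ∃ u' : ℂ, St η f x₀ s hmax R Hs B (j + 1) u' ∧ |u'.im| ≤ |u.im| + lam j) ∧
      ∀ k : ℕ, σ η f x₀ s hmax R Hs B k + (∑ j ∈ Finset.range k,
          (if Charged P St Ready η f x₀ s hmax R Hs B j then
              (if 𝓔 η f x₀ s hmax R Hs B j then (1 : ℝ) else 0) + lam j / (μ * s) else 0))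
        ≤ β η f x₀ s hmax R Hs B

open Classical in
/-- ★★ **(K) LINEAGE ⇒ (β-low)** (kernel): β-sharpened INIT ∧ lineage law ∧ rest budget ⇒ the priced census (any 𝓔, σ, β, M). -/
theorem census_of_lineage {μ cE : ℝ} (hμ : 0 < μ) {P St Ready : StatePred} {𝓔 : LevelClass} {σ : LevelMeter} {β : Budget} {M : LevelMeter}
    (hI : InitSharpG cE β M) (hL : LineageLawG P St Ready 𝓔 σ M) (hR : RestBudgetG μ P St Ready 𝓔 σ β M) :
    DenseLevelCensusLow μ cE P St Ready := by
  refine denseLevelCensusLow_of_prefix hμ (M := fun _ _ _ _ _ _ _ _ _ => 0) ?_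
  intro η f x₀ s hmax R Hs B hE
  classical
  obtain ⟨lam, hlam0, hsucc, hrest⟩ := hR η f x₀ s hmax R Hs B hE
  have hinit := hI η f x₀ s hmax R Hs B hE
  have hlin := hL η f x₀ s hmax R Hs B hE
  refine ⟨lam, hlam0, fun _ => le_rfl, hsucc, ?_⟩
  intro k
  -- cost = injected charges + rest, summand by summand
  have hsplit : ∀ j : ℕ,
      (if Charged P St Ready η f x₀ s hmax R Hs B j then 1 + lam j / (μ * s) else 0)
        = (if Charged P St Ready η f x₀ s hmax R Hs B j ∧ ¬ 𝓔 η f x₀ s hmax R Hs B j then (1 : ℝ) else 0)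
          + (if Charged P St Ready η f x₀ s hmax R Hs B j then
              (if 𝓔 η f x₀ s hmax R Hs B j then (1 : ℝ) else 0) + lam j / (μ * s) else 0) := by
    intro j
    by_cases hc : Charged P St Ready η f x₀ s hmax R Hs B j
    · by_cases he : 𝓔 η f x₀ s hmax R Hs B j
      · rw [if_pos hc, if_neg (fun h : Charged P St Ready η f x₀ s hmax R Hs B j ∧ ¬ 𝓔 η f x₀ s hmax R Hs B j => h.2 he),
          if_pos hc, if_pos he]
        ring
      · rw [if_pos hc, if_pos (show Charged P St Ready η f x₀ s hmax R Hs B j ∧ ¬ 𝓔 η f x₀ s hmax R Hs B j from ⟨hc, he⟩),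
          if_pos hc, if_neg he]
        ring
    · rw [if_neg hc, if_neg (fun h : Charged P St Ready η f x₀ s hmax R Hs B j ∧ ¬ 𝓔 η f x₀ s hmax R Hs B j => hc h.1), if_neg hc]
      ring
  have hsum : (∑ j ∈ Finset.range k, (if Charged P St Ready η f x₀ s hmax R Hs B j then 1 + lam j / (μ * s) else 0))
      = (∑ j ∈ Finset.range k, (if Charged P St Ready η f x₀ s hmax R Hs B j ∧ ¬ 𝓔 η f x₀ s hmax R Hs B j then (1 : ℝ) else 0))
        + ∑ j ∈ Finset.range k, (if Charged P St Ready η f x₀ s hmax R Hs B j then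
              (if 𝓔 η f x₀ s hmax R Hs B j then (1 : ℝ) else 0) + lam j / (μ * s) else 0) := by
    rw [← Finset.sum_add_distrib]
    exact Finset.sum_congr rfl fun j _ => hsplit j
  have h1 := hlin k
  have h2 := hrest k
  rw [hsum]
  simp only [add_zero]
  linarith

/-- lineage law / rest budget at the node's literals. -/
def LineageLaw (P : StatePred) (𝓔 : LevelClass) (σ M : LevelMeter) : Prop := LineageLawG P StCol' (CumReady WindowReady) 𝓔 σ M

/-- W-07 E3 support (E01 §L, C1 rh-idea-5 g20): see the module docstring and the source README. -/
def RestBudget (P : StatePred) (𝓔 : LevelClass) (σ : LevelMeter) (β : Budget) (M : LevelMeter) : Prop :=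
  RestBudgetG (1 / 4) P StCol' (CumReady WindowReady) 𝓔 σ β M

/-- ★★ (K) the c14 node in LINEAGE shape ⇒ (β-low). -/
theorem denseLevelCensusStopLow_of_lineage {P : StatePred} {𝓔 : LevelClass} {σ : LevelMeter} {β : Budget} {M : LevelMeter}
    (hI : InitSharp β M) (hL : LineageLaw P 𝓔 σ M) (hR : RestBudget P 𝓔 σ β M) : DenseLevelCensusStopLow P :=
  census_of_lineage (by norm_num) hI hL hR

/-- (K) … and on to `DescentSigS'`. -/
theorem descentSigS'_of_lineage {𝓔 : LevelClass} {σ : LevelMeter} {β : Budget} {M : LevelMeter}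
    (hI : InitSharp β M) (hL : LineageLaw PSealC4 𝓔 σ M) (hR : RestBudget PSealC4 𝓔 σ β M) (hα : IsolatedPairDropLow PSealC4) :
    DescentSigS' :=
  descentSigS'_of_fieldSplitLowLow hα (denseLevelCensusStopLow_of_lineage hI hL hR)

open Classical in
/-- (c5 witness) the lineage law is VACUOUS for 𝓔 = ⊤ (everything excepted), given σ ≥ 0 and M … 0 ≥ 0. -/
theorem lineageLawG_top {P St Ready : StatePred} {σ M : LevelMeter}
    (hM : ∀ η f x₀ s hmax R Hs B, 0 ≤ M η f x₀ s hmax R Hs B 0) (hσ : ∀ η f x₀ s hmax R Hs B k, 0 ≤ σ η f x₀ s hmax R Hs B k) :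
    LineageLawG P St Ready (fun _ _ _ _ _ _ _ _ _ => True) σ M := by
  intro η f x₀ s hmax R Hs B _ k
  rw [Finset.sum_eq_zero]
  · have := hM η f x₀ s hmax R Hs B
    have := hσ η f x₀ s hmax R Hs B k
    linarith
  · intro j _
    simp

/-- (K-c14-3 / C6 ADD-31 in the TYPE) the INIT-slack budget `β := purse − M 0` is a legal `Budget` (it reads f through M) and makes
`InitSharpG` an identity. -/
noncomputable def slackBudget (cE : ℝ) (M : LevelMeter) : Budget := fun η f x₀ s hmax R Hs B => (Hs / s) ^ 2 + (B : ℝ) + cE - M η f x₀ s hmax R Hs B 0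

/-- W-07 E3 support (E01 §L, C1 rh-idea-5 g20): see the module docstring and the source README. -/
theorem initSharpG_slack (cE : ℝ) (M : LevelMeter) : InitSharpG cE (slackBudget cE M) M := by
  intro η f x₀ s hmax R Hs B _
  simp only [slackBudget]
  linarith
end RhW07.C14.Lineage

namespace RhW07.C14.Booking

open Complex
open RhIdea6.G17.W07C7 RhIdea6.G17.W07C7.Rev6 RhIdea6.G18.W07C8.Law421BirthS RhIdea6.G19.W07C11.Seam
open RhIdea6.G20.W07C12.Frac RhIdea6.G20.W07C12.StColP RhW07.C12.FieldSplit
open RhW07.C14.TwoSided RhW07.C14.Lineage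

open Classical in
/-- the INJECTION COUNT below `k`: the number of charged levels `j < k` outside the exception class 𝓔 (left side of `LineageLawG`, verbatim). -/
noncomputable def injected (P St Ready : StatePred) (𝓔 : LevelClass) (η : ℝ) (f : ℂ → ℂ) (x₀ s hmax R Hs : ℝ) (B : ℕ) (k : ℕ) : ℝ :=
  ∑ j ∈ Finset.range k, (if Charged P St Ready η f x₀ s hmax R Hs B j ∧ ¬ 𝓔 η f x₀ s hmax R Hs B j then (1 : ℝ) else 0)

open Classical in
/-- (K) the injection count is a natural number: the cardinality of the set of injected levels below `k`. -/
theorem injected_eq_card (P St Ready : StatePred) (𝓔 : LevelClass) (η : ℝ) (f : ℂ → ℂ) (x₀ s hmax R Hs : ℝ) (B k : ℕ) :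
    injected P St Ready 𝓔 η f x₀ s hmax R Hs B k =
      (((Finset.range k).filter fun j => Charged P St Ready η f x₀ s hmax R Hs B j ∧ ¬ 𝓔 η f x₀ s hmax R Hs B j).card : ℝ) := by
  unfold injected
  rw [Finset.natCast_card_filter]

/-- the VIRTUAL RESERVE (booking meter) of the lineage split: level-0 booking `M … 0` plus settlers below `k` minus injections below `k`. -/
noncomputable def bookingMeter (P St Ready : StatePred) (𝓔 : LevelClass) (σ M : LevelMeter) : LevelMeter := fun η f x₀ s hmax R Hs B k =>
  M η f x₀ s hmax R Hs B 0 + σ η f x₀ s hmax R Hs B k - injected P St Ready 𝓔 η f x₀ s hmax R Hs B k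

/-- ★ (K) the LINEAGE LAW IS non-negativity of the virtual reserve at every level. -/
theorem lineageLawG_iff_booking_nonneg {P St Ready : StatePred} {𝓔 : LevelClass} {σ M : LevelMeter} :
    LineageLawG P St Ready 𝓔 σ M ↔
      ∀ (η : ℝ) (f : ℂ → ℂ) (x₀ s hmax R Hs : ℝ) (B : ℕ), EngineHyps5 2 η f x₀ s hmax R Hs B →
        ∀ k : ℕ, 0 ≤ bookingMeter P St Ready 𝓔 σ M η f x₀ s hmax R Hs B k := by
  constructor
  · intro h η f x₀ s hmax R Hs B hE k
    have h1 := h η f x₀ s hmax R Hs B hE k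
    show 0 ≤ M η f x₀ s hmax R Hs B 0 + σ η f x₀ s hmax R Hs B k - injected P St Ready 𝓔 η f x₀ s hmax R Hs B k
    unfold injected
    linarith
  · intro h η f x₀ s hmax R Hs B hE k
    have h1 : 0 ≤ M η f x₀ s hmax R Hs B 0 + σ η f x₀ s hmax R Hs B k - injected P St Ready 𝓔 η f x₀ s hmax R Hs B k :=
      h η f x₀ s hmax R Hs B hE k
    unfold injected at h1
    linarith

open Classical in
/-- (K) cost = injections + rest, summand by summand (§L's split, as a named lemma). -/
theorem cost_split (P St Ready : StatePred) (𝓔 : LevelClass) (η : ℝ) (f : ℂ → ℂ) (x₀ s hmax R Hs : ℝ) (B : ℕ)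
    (μ : ℝ) (lam : ℕ → ℝ) (k : ℕ) :
    (∑ j ∈ Finset.range k, (if Charged P St Ready η f x₀ s hmax R Hs B j then 1 + lam j / (μ * s) else 0))
      = injected P St Ready 𝓔 η f x₀ s hmax R Hs B k
        + ∑ j ∈ Finset.range k, (if Charged P St Ready η f x₀ s hmax R Hs B j then
              (if 𝓔 η f x₀ s hmax R Hs B j then (1 : ℝ) else 0) + lam j / (μ * s) else 0) := by
  unfold injected
  rw [← Finset.sum_add_distrib]
  refine Finset.sum_congr rfl fun j _ => ?_
  by_cases hc : Charged P St Ready η f x₀ s hmax R Hs B j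
  · by_cases he : 𝓔 η f x₀ s hmax R Hs B j
    · rw [if_pos hc, if_neg (fun h : Charged P St Ready η f x₀ s hmax R Hs B j ∧ ¬ 𝓔 η f x₀ s hmax R Hs B j => h.2 he),
        if_pos hc, if_pos he]
      ring
    · rw [if_pos hc, if_pos (show Charged P St Ready η f x₀ s hmax R Hs B j ∧ ¬ 𝓔 η f x₀ s hmax R Hs B j from ⟨hc, he⟩),
        if_pos hc, if_neg he]
      ring
  · rw [if_neg hc, if_neg (fun h : Charged P St Ready η f x₀ s hmax R Hs B j ∧ ¬ 𝓔 η f x₀ s hmax R Hs B j => hc h.1), if_neg hc]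
    ring

open Classical in
/-- ★★ **(K) THE (iv) CELL IS THE PREFIX LAW WITH THE VIRTUAL RESERVE**: β-sharpened INIT ∧ lineage law ∧ rest budget ⇒
`MonovariantPrefixG` with meter `bookingMeter` (any 𝓔, σ, β, M).  §L's `census_of_lineage` is this followed by `denseLevelCensusLow_of_prefix`. -/
theorem prefixG_of_lineage {μ cE : ℝ} {P St Ready : StatePred} {𝓔 : LevelClass} {σ : LevelMeter} {β : Budget} {M : LevelMeter}
    (hI : InitSharpG cE β M) (hL : LineageLawG P St Ready 𝓔 σ M) (hR : RestBudgetG μ P St Ready 𝓔 σ β M) :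
    MonovariantPrefixG μ cE P St Ready (bookingMeter P St Ready 𝓔 σ M) := by
  intro η f x₀ s hmax R Hs B hE
  classical
  obtain ⟨lam, hlam0, hsucc, hrest⟩ := hR η f x₀ s hmax R Hs B hE
  have hinit := hI η f x₀ s hmax R Hs B hE
  have hlin := (lineageLawG_iff_booking_nonneg.mp hL) η f x₀ s hmax R Hs B hE
  refine ⟨lam, hlam0, hlin, hsucc, ?_⟩
  intro k
  have h2 := hrest k
  rw [cost_split P St Ready 𝓔 η f x₀ s hmax R Hs B μ lam k]
  show injected P St Ready 𝓔 η f x₀ s hmax R Hs B k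
      + (∑ j ∈ Finset.range k, (if Charged P St Ready η f x₀ s hmax R Hs B j then
            (if 𝓔 η f x₀ s hmax R Hs B j then (1 : ℝ) else 0) + lam j / (μ * s) else 0))
      + (M η f x₀ s hmax R Hs B 0 + σ η f x₀ s hmax R Hs B k - injected P St Ready 𝓔 η f x₀ s hmax R Hs B k)
      ≤ (Hs / s) ^ 2 + B + cE
  linarith

open Classical in
/-- (K) the REST BUDGET is ANTITONE in 𝓔: shrinking the exception class bills fewer base units (the lifts and their tolls are unchanged). -/
theorem restBudgetG_anti_E {μ : ℝ} {P St Ready : StatePred} {𝓔 𝓔' : LevelClass} {σ : LevelMeter} {β : Budget} {M : LevelMeter}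
    (hsub : ∀ η f x₀ s hmax R Hs B j, 𝓔 η f x₀ s hmax R Hs B j → 𝓔' η f x₀ s hmax R Hs B j)
    (h : RestBudgetG μ P St Ready 𝓔' σ β M) : RestBudgetG μ P St Ready 𝓔 σ β M := by
  intro η f x₀ s hmax R Hs B hE
  obtain ⟨lam, hlam0, hsucc, hrest⟩ := h η f x₀ s hmax R Hs B hE
  refine ⟨lam, hlam0, hsucc, fun k => le_trans ?_ (hrest k)⟩
  have hsum : (∑ j ∈ Finset.range k, (if Charged P St Ready η f x₀ s hmax R Hs B j then
          (if 𝓔 η f x₀ s hmax R Hs B j then (1 : ℝ) else 0) + lam j / (μ * s) else 0))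
      ≤ ∑ j ∈ Finset.range k, (if Charged P St Ready η f x₀ s hmax R Hs B j then
          (if 𝓔' η f x₀ s hmax R Hs B j then (1 : ℝ) else 0) + lam j / (μ * s) else 0) := by
    refine Finset.sum_le_sum fun j _ => ?_
    by_cases hc : Charged P St Ready η f x₀ s hmax R Hs B j
    · simp only [if_pos hc]
      have hind : (if 𝓔 η f x₀ s hmax R Hs B j then (1 : ℝ) else 0) ≤ (if 𝓔' η f x₀ s hmax R Hs B j then (1 : ℝ) else 0) := by
        by_cases he : 𝓔 η f x₀ s hmax R Hs B j
        · simp only [if_pos he, if_pos (hsub _ _ _ _ _ _ _ _ _ he), le_refl]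
        · simp only [if_neg he]
          split_ifs <;> norm_num
      linarith
    · simp only [if_neg hc, le_refl]
  linarith
end RhW07.C14.Booking
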